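import Mathlib
import HarnessLib
import Literature.Analysis.FluidPDE.BarkerPrange2020VorticityAlignmentTypeI
import Literature.Analysis.FluidPDE.LocalTypeIBlowup.SingularVertexZoom
import Literature.Analysis.FluidPDE.GigaMiura2011UnidirectionalVorticityHolds
import Literature.Analysis.FluidPDE.KNSSTypeIRateLiouvilleHolds
import Literature.Analysis.FluidPDE.OseenZoomCovariance
import Literature.Analysis.FluidPDE.BoundedWeakIsometry
import Literature.Analysis.FluidPDE.NSBoundedMildAnalytic
import Literature.Analysis.FluidPDE.NSLocalLerayBackwardUniqueness
import Literature.Analysis.FluidPDE.OseenMildUniqueness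
import Literature.Analysis.FluidPDE.LocalTypeIWeakSerrinProofs
import Literature.Analysis.FluidPDE.SereginSverak2002VertexBlowupLimit
import Literature.Analysis.FluidPDE.NSViscosityRescaling
import Literature.Analysis.FluidPDE.NSLerayHopfABCScaling
import Literature.Analysis.FluidPDE.SlabPressureNormalization

/-!
# Barker–Prange 2020, Theorem 3 (vorticity alignment / bounded vorticity on concentrating balls
# versus Type I blow-up, whole space): discharge

Analysis/FluidPDE proof file (theorems only: no definition, no named fact, no `sorry`):
`barkerPrange2020_alignment_concentrating_typeI_holds` proves the named fact
`barkerPrange2020_alignment_concentrating_typeI` of `BarkerPrange2020VorticityAlignmentTypeI.lean`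
(T. Barker, C. Prange, *Scale-invariant estimates and vorticity alignment for Navier–Stokes in the
half-space with no-slip boundary conditions*, Arch. Ration. Mech. Anal. 235 (2020) 881–926 =
arXiv:1906.08225, §5 **Theorem 3** ((5.3)–(5.4), p. 18, the WHOLE-SPACE theorem): a classical
Leray–Hopf solution with the global Type-I bound `|u| ≤ M/√(T − t)` whose vorticity is bounded,
or whose vorticity direction has a uniform modulus of continuity on `{|ω| > d}`, on the
concentrating balls `B(x₀, δ√(ν(T − t⁽ⁿ⁾)))` along a sequence `t⁽ⁿ⁾ ↑ T`, is regular at `(T, x₀)`).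

## The printed proof and the proof given here

Barker–Prange prove Theorem 3 by the proof of their half-space Theorem 1 ("The proof is
essentially the same to that of Theorem 1, hence we omit it. The difference is that one takes
`R⁽ⁿ⁾ := √(T − t⁽ⁿ⁾)` and then rescales", p. 18). That proof (§4, pp. 16–17) runs: Step 1 — local
Morrey bounds: Theorem 2, "the Type I condition implies `sup_r (A + E + D_{3/2}) ≤ M'`" (in the
interior case "established by Seregin and Zajaczkowski", p. 6; the tree's PROVED
`albrittonBarker2019_lemma_2_5_rate_holds`); Step 2 — "zoom in on the singularity": rescale at
the prescribed vertex `(x₀, T)` by the prescribed scales `R⁽ⁿ⁾`; Step 3 — "passage to the limit":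
"using the above a priori estimates and Lemma 3 [persistence of singularities, Rusin–Šverák /
Albritton–Barker Prop. 2.3] we obtain a limiting suitable weak solution … `u^(∞)` has a singular
point at `(0,0)`", Type I, mild (the tree's `LocalTypeIBlowup.exists_typeIAncientMild_zoomLimit`,
file `SingularVertexZoom`); Step 4 — the continuous alignment along the zoom makes the vorticity of
the limit slice `ω^(∞)(·, −t₀)` point in ONE direction on the rescaled ball ("This essentially
follows from the same reasoning as in [GM11]", p. 16; here `dir_eq_of_sliceAligned_along`), and the
bounded-vorticity hypothesis (5.3) makes it vanish there (§5.1, p. 18); Step 5 — Proposition 4 (a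
Type-I mild ancient solution, singular at `(0,0)`, whose vorticity slice is unidirectional on a
LARGE ball `B(γ(M, M'))`, is regular at `(0,0)`: contradiction), proved in §4 pp. 15–16 by a second
compactness argument, the harmonic Liouville theorem, a reduction to a two-dimensional flow and the
regularity of two-dimensional Leray–Hopf solutions.

The proof below follows Steps 1–4 as printed and deviates in Step 5 at two places, each replacing
a printed ingredient the tree does not have by a printed ingredient it has:

* (D1) the globalisation "unidirectional on `B(γ)` ⇒ two-dimensional" is obtained from the SPACE
  ANALYTICITY of bounded mild solutions (Lemarié-Rieusset 2016, Thm. 9.12, the tree's PROVED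
  `lemarieRieusset2016_local_analyticity_holds`, with the uniqueness of bounded Oseen-mild
  solutions `oseenMild_bounded_unique` and the identity theorem) instead of Proposition 4's
  compactness over `γ⁽ᵏ⁾ ↑ ∞` — so the printed `δ(M, u₀)` may be taken to be ANY positive number
  (we witness the printed `∃ δ` with `δ = 1`; the fact is stated with `∃ δ`, as printed);
* (D2) the ending of Proposition 4 (2D Leray–Hopf regularity) is replaced by the alternative
  printed in the same paper, **Remark 5** ("alternative argument suggested by Seregin", p. 5: the
  singular solution with alignment produces "a non-trivial two-dimensional whole-space mild
  bounded ancient solution … Such a `ū` then must be zero by applying a Liouville theorem proven in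
  [KNSS 2009]"): the slice lemma `translationInvariant_of_curl_parallel` (Giga–Miura 2011 Prop. 2.2
  step 1, which contains the printed harmonic-Liouville step "`Δu₁^(∞) = 0`, … `u₁^(∞) ∈ L_∞(ℝ³₊)`.
  By the classical Liouville theorem for the Laplace equation, we infer `u₁^(∞) ≡ 0`", p. 15)
  makes the limit slice translation invariant along the alignment direction `e`; uniqueness of
  bounded Oseen-mild solutions propagates the invariance forward in time
  (`translationInvariant_after_of_oseenMild`, [GIM]/KNSS §4); a SECOND zoom at the singular origin
  (the same `exists_typeIAncientMild_zoomLimit`, persistence again) yields a Type-I ancient mild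
  solution invariant along `e` at ALL times and still singular at the origin; after a rotation
  taking `e` to a coordinate axis (`oseenDuhamel_symm_conj_linearIsometryEquiv`,
  `heatExtension_conj_linearIsometryEquiv`) the Liouville step of the proof of KNSS 2009, Thm. 6.2
  (Thm. 5.1 + Remark 6.1 + the axial half; the tree's PROVED `KNSS2009_typeI_rate_liouville_holds`)
  shows that it vanishes identically — contradicting the singular origin.

The viscosity is normalised to `ν = 1` by `v(τ, x) = ν⁻¹ u(τ/ν, x)`
(`IsClassicalNSSolutionOn.viscosityRescale_set`, `IsLerayHopfOn.viscosityRescale`), exactly as the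
fact's docstring transcribes the printed `ν = 1` statement. Nothing here is a claim about
Navier–Stokes regularity beyond the printed conditional criterion; no new notion and no new named
fact is introduced (net debt −1).

## References

* T. Barker, C. Prange, Arch. Ration. Mech. Anal. 235 (2020) 881–926 = arXiv:1906.08225: §1
  Lemma 3, Prop. 4, Remark 5 (pp. 4–5); Thm. 2 (p. 6); §4 proof of Prop. 4 (p. 15) and of Thm. 1
  (pp. 16–17); §5.1 and Thm. 3, Remark 15 (p. 18). Page numbers = chunk numbers of the held text
  `paper:arxiv-1906.08225`. [BarkerPrange2020Alignment]
* Y. Giga, H. Miura, Comm. Math. Phys. 303 (2011) 289–300, Prop. 2.2 (proof, step 1).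
  [GigaMiura2011]
* G. Koch, N. Nadirashvili, G. Seregin, V. Šverák, Acta Math. 203 (2009) = arXiv:0709.3599,
  Thm. 5.1, Remark 6.1, proof of Thm. 6.2 (p. 13), §4. [KochNadirashviliSereginSverak2009]
* D. Albritton, T. Barker, J. Math. Fluid Mech. 21 (2019) = arXiv:1811.00502, Lemma 2.5,
  Prop. 2.3, §3. [AlbrittonBarker2019]
* G. Seregin, V. Šverák, Comm. PDE 34 (2009) = arXiv:0804.1803, Thm. 2.8. [SereginSverak2009]
* P. G. Lemarié-Rieusset, *The Navier–Stokes Problem in the 21st Century* (2016), Thm. 9.12.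
  [LemarieRieusset2016]
-/

noncomputable section

open MeasureTheory Set Function Filter Topology TopologicalSpace Metric
open scoped NNReal ENNReal RealInnerProductSpace
open Literature.Analysis Literature.Analysis.FluidPDE Literature.Analysis.FluidPDE.LocalTypeIBlowup

namespace Literature.Analysis.FluidPDE

/-! ### Step 5, ingredient (D1): slices of Type-I ancient mild fields are real-analytic -/

/-- **Slices of a Type-I ancient mild field are real-analytic on `ℝ³`** (Lemarié-Rieusset 2016,
Thm. 9.12: bounded mild solutions are analytic in space and time; the tree's PROVED local form
`lemarieRieusset2016_local_analyticity_holds` — the Oseen fixed point from a bounded datum is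
jointly real-analytic on its window — identified with the given field by the uniqueness of bounded
Oseen-mild solutions, `oseenMild_bounded_unique`). [cite: LemarieRieusset2016, Thm. 9.12 (PDF p. 260)] -/
theorem IsTypeIAncientMild.analyticOnNhd_slice_univ {C : ℝ}
    {U : ℝ → (EuclideanSpace ℝ (Fin 3)) → (EuclideanSpace ℝ (Fin 3))}
    (h : IsTypeIAncientMild C U) {t : ℝ} (ht : t < 0) :
    AnalyticOnNhd ℝ (U t) univ := by
  obtain ⟨ε, hε, C₀, hC₀, hloc⟩ := lemarieRieusset2016_local_analyticity_holds
  have hC : 0 ≤ C := h.nonneg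
  -- a uniform bound `B` of `U` on the times `≤ t/2 < 0`
  set B : ℝ := C / Real.sqrt (-(t / 2)) with hB
  have hB0 : 0 ≤ B := div_nonneg hC (Real.sqrt_nonneg _)
  have hnormle : ∀ τ, τ ≤ t / 2 → ∀ x, ‖U τ x‖ ≤ B := by
    intro τ hτ x
    have hτ0 : τ < 0 := by linarith
    refine (h.norm_le hτ0 x).trans ?_
    exact div_le_div_of_nonneg_left hC (Real.sqrt_pos.2 (by linarith)) (Real.sqrt_le_sqrt (by linarith))
  set Mb : ℝ := B + 1 with hMb
  have hMb0 : 0 < Mb := by rw [hMb]; linarith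
  have hlen : 0 < ε * 1 / Mb ^ 2 := by positivity
  -- the initial time of the analytic window
  set s₁ : ℝ := t - (ε * 1 / Mb ^ 2) / 2 with hs₁
  have hs₁t : s₁ < t := by rw [hs₁]; linarith
  have hs₁0 : s₁ < 0 := by linarith
  have ha_meas : AEStronglyMeasurable (U s₁) volume := (h.continuous_slice hs₁0).aestronglyMeasurable
  have ha_bd : eLpNorm (U s₁) ∞ volume ≤ ENNReal.ofReal Mb := by
    rw [eLpNorm_exponent_top]
    refine eLpNormEssSup_le_of_ae_bound (Eventually.of_forall fun x => ?_)
    exact (hnormle s₁ (by linarith) x).trans (by rw [hMb]; linarith)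
  obtain ⟨vl, hvl_an, hvl_eq, hvl_bd⟩ := hloc one_pos s₁ hMb0 ha_meas ha_bd
  -- the common window `(s₁, T₂)`, `T₂ = min (s₁ + ε/Mb²) (t/2) ∋ t`
  set T₂ : ℝ := min (s₁ + ε * 1 / Mb ^ 2) (t / 2) with hT₂
  have htT₂ : t < T₂ := lt_min (by rw [hs₁]; linarith) (by linarith)
  have hT₂0 : T₂ < 0 := (min_le_right _ _).trans_lt (by linarith)
  have hT₂h : T₂ ≤ s₁ + ε * 1 / Mb ^ 2 := min_le_left _ _
  have hT₂t : T₂ ≤ t / 2 := min_le_right _ _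
  -- uniqueness of bounded Oseen-mild solutions on the window
  set M' : ℝ := max B (C₀ * Mb) with hM'
  have hM'0 : 0 ≤ M' := hB0.trans (le_max_left _ _)
  have hum : AEStronglyMeasurable (uncurry U) (volume.restrict (Ioo s₁ T₂ ×ˢ univ)) :=
    (h.continuousOn_uncurry.mono (prod_mono (fun τ hτ => mem_Iio.2 ((mem_Ioo.1 hτ).2.trans hT₂0))
      Subset.rfl)).aestronglyMeasurable (measurableSet_Ioo.prod MeasurableSet.univ)
  have hvm : AEStronglyMeasurable (uncurry vl) (volume.restrict (Ioo s₁ T₂ ×ˢ univ)) :=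
    (hvl_an.continuousOn.mono (prod_mono (Ioo_subset_Ioo_right hT₂h) Subset.rfl)).aestronglyMeasurable
      (measurableSet_Ioo.prod MeasurableSet.univ)
  have huM : ∀ τ ∈ Ioo s₁ T₂, ∀ y, ‖U τ y‖ ≤ M' := fun τ hτ y =>
    (hnormle τ (hτ.2.le.trans hT₂t) y).trans (le_max_left _ _)
  have hvM : ∀ τ ∈ Ioo s₁ T₂, ∀ y, ‖vl τ y‖ ≤ M' := fun τ hτ y =>
    (hvl_bd τ ⟨hτ.1, hτ.2.trans_le hT₂h⟩ y).trans (le_max_right _ _)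
  have hu : ∀ τ ∈ Ioo s₁ T₂, U τ =ᵐ[volume] fun x =>
      UnboundedOperators.heatExtension (U s₁) (1 * (τ - s₁)) x - oseenDuhamel 1 s₁ U U τ x :=
    fun τ hτ => Eventually.of_forall fun x => by
      rw [one_mul]
      exact h.mild_eq_heatExtension hτ.1 (hτ.2.trans hT₂0) x
  have hv : ∀ τ ∈ Ioo s₁ T₂, vl τ =ᵐ[volume] fun x =>
      UnboundedOperators.heatExtension (U s₁) (1 * (τ - s₁)) x - oseenDuhamel 1 s₁ vl vl τ x :=
    fun τ hτ => Eventually.of_forall fun x => hvl_eq τ ⟨hτ.1, hτ.2.trans_le hT₂h⟩ x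
  have heq := oseenMild_bounded_unique
    (U := fun τ x => UnboundedOperators.heatExtension (U s₁) (1 * (τ - s₁)) x)
    one_pos hM'0 hum hvm huM hvM hu hv t ⟨hs₁t, htT₂⟩
  have htwin : t ∈ Ioo s₁ (s₁ + ε * 1 / Mb ^ 2) := ⟨hs₁t, htT₂.trans_le hT₂h⟩
  have hvlt : AnalyticOnNhd ℝ (vl t) univ := analyticOnNhd_slice hvl_an htwin
  have hUt : U t = vl t :=
    (Continuous.ae_eq_iff_eq volume (h.continuous_slice ht) (continuousOn_univ.1 hvlt.continuousOn)).1 heq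
  rw [hUt]
  exact hvlt

/-- **Globalisation by analyticity**: if a real-analytic field `V` on `ℝ³` has its curl parallel
to a fixed vector `e` on a non-empty open set (`curl V = a(y) e` there, any signs, `a = 0`
allowed), then `curl V` is parallel to `e` everywhere (the analytic map
`curl V − (⟪curl V, e⟫/‖e‖²) e` vanishes on the open set, hence on the connected `ℝ³`; for `e = 0`
this is the identity theorem for `curl V` itself). This replaces the compactness over large balls
in Barker–Prange's Proposition 4 (deviation (D1) of the module docstring). [cite: LemarieRieusset2016, Thm. 9.12 (analyticity) with the identity theorem; BarkerPrange2020Alignment, Prop. 4 (arXiv:1906.08225 p. 5)] -/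
theorem curl_parallel_of_parallel_on_open
    {V : (EuclideanSpace ℝ (Fin 3)) → (EuclideanSpace ℝ (Fin 3))} (hV : AnalyticOnNhd ℝ V univ)
    {S : Set (EuclideanSpace ℝ (Fin 3))} (hS : IsOpen S) (hne : S.Nonempty)
    {e : EuclideanSpace ℝ (Fin 3)} (h : ∀ y ∈ S, ∃ a : ℝ, curl V y = a • e) :
    ∀ y, ∃ a : ℝ, curl V y = a • e := by
  by_cases he : e = 0
  · have h0 : ∀ y ∈ S, curl V y = 0 := fun y hy => by
      obtain ⟨a, ha⟩ := h y hy
      rw [ha, he, smul_zero]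
    intro y
    exact ⟨0, by rw [curl_eq_zero_of_eqOn_open hV hS hne h0 y, zero_smul]⟩
  · have hne2 : ‖e‖ ^ 2 ≠ 0 := pow_ne_zero 2 (norm_ne_zero_iff.2 he)
    set F : (EuclideanSpace ℝ (Fin 3)) → (EuclideanSpace ℝ (Fin 3)) :=
      fun y => curl V y - (⟪curl V y, e⟫ / ‖e‖ ^ 2) • e with hF
    have hc : AnalyticOnNhd ℝ (curl V) univ := analyticOnNhd_curl hV
    have hinner : AnalyticOnNhd ℝ (fun y => ⟪curl V y, e⟫ / ‖e‖ ^ 2) univ := by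
      have h1 : AnalyticOnNhd ℝ (fun y => (innerSL ℝ e) (curl V y)) univ :=
        (innerSL ℝ e).comp_analyticOnNhd hc
      have h2 : (fun y => ⟪curl V y, e⟫ / ‖e‖ ^ 2) = fun y => (innerSL ℝ e) (curl V y) * (‖e‖ ^ 2)⁻¹ := by
        funext y
        rw [innerSL_apply_apply, real_inner_comm, div_eq_mul_inv]
      rw [h2]
      exact h1.mul analyticOnNhd_const
    have hFan : AnalyticOnNhd ℝ F univ := hc.sub (hinner.smul analyticOnNhd_const)
    obtain ⟨y₀, hy₀⟩ := hne
    have hF0 : F =ᶠ[𝓝 y₀] 0 := by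
      filter_upwards [hS.mem_nhds hy₀] with y hy
      obtain ⟨a, ha⟩ := h y hy
      simp only [hF, ha, Pi.zero_apply, inner_smul_left, real_inner_self_eq_norm_sq, RCLike.conj_to_real]
      rw [mul_div_assoc, div_self hne2, mul_one, sub_self]
    have hFzero := hFan.eqOn_zero_of_preconnected_of_eventuallyEq_zero isPreconnected_univ (mem_univ y₀) hF0
    intro y
    have hy := hFzero (mem_univ y)
    simp only [hF, Pi.zero_apply, sub_eq_zero] at hy
    exact ⟨_, hy⟩

/-! ### Step 5, ingredient (D2): the Liouville-type end (Remark 5 / KNSS) -/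

/-- A linear isometry of `ℝ³` taking the coordinate vector `e₁` (Lean index `1`) to a given unit
vector (a Householder reflection, `Submodule.reflection_sub`). [folklore] -/
private theorem exists_linearIsometryEquiv_map_single_one {a : EuclideanSpace ℝ (Fin 3)} (ha : ‖a‖ = 1) :
    ∃ R : (EuclideanSpace ℝ (Fin 3)) ≃ₗᵢ[ℝ] (EuclideanSpace ℝ (Fin 3)),
      R (EuclideanSpace.single (1 : Fin 3) (1 : ℝ)) = a := by
  have h1 : ‖(EuclideanSpace.single (1 : Fin 3) (1 : ℝ) : EuclideanSpace ℝ (Fin 3))‖ = ‖a‖ := by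
    rw [ha]
    simp
  exact ⟨_, Submodule.reflection_sub h1⟩

/-- **Translation invariance along a vector propagates forward in time** for Type-I ancient mild
fields (cf. Barker–Prange 2020, proof of Prop. 4 Step 3, p. 15: "Using that `u^(∞)` is a mild
solution on `ℝ³₊ × (−∞,0)` and that `u^(∞)` is bounded locally in space-time, we may use the
uniqueness of `L_∞` mild solutions"; in the
tree: `translationInvariant_after_of_oseenMild` — uniqueness of bounded Oseen-mild solutions,
[GIM] / KNSS 2009 §4 — applied to the time-shifted copies `τ ↦ V(τ − δ)`, which are bounded).
[cite: BarkerPrange2020Alignment, proof of Prop. 4 Step 3 (arXiv:1906.08225 p. 15); KochNadirashviliSereginSverak2009, §4 (uniqueness)] -/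
theorem IsTypeIAncientMild.comp_add_eq_after {C : ℝ}
    {V : ℝ → (EuclideanSpace ℝ (Fin 3)) → (EuclideanSpace ℝ (Fin 3))} (hV : IsTypeIAncientMild C V)
    {s : ℝ} (hs : s < 0) {b : EuclideanSpace ℝ (Fin 3)} (hb : ∀ x, V s (x + b) = V s x) :
    ∀ t, s < t → t < 0 → ∀ x, V t (x + b) = V t x := by
  intro t hst ht x
  set δ : ℝ := -t / 2 with hδdef
  have hδ : 0 < δ := by rw [hδdef]; linarith
  have hVδ := hV.comp_sub_right hδ.le
  obtain ⟨K, hK⟩ := hV.isBoundedOn hδ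
  have hbd : ∃ K : ℝ, ∀ τ < 0, ∀ x, ‖(fun τ => V (τ - δ)) τ x‖ ≤ K :=
    ⟨K, fun τ hτ x => hK (τ - δ) (by simp only [mem_Iio]; linarith) x⟩
  have key := translationInvariant_after_of_oseenMild (v := fun τ => V (τ - δ)) hVδ.continuousOn_uncurry
    hbd (fun s' t' hst' ht' x => hVδ.mild_eq_heatExtension hst' ht' x)
    (s := s + δ) (by rw [hδdef]; linarith) (b := b)
    (fun x => by simp only [add_sub_cancel_right]; exact hb x)
    (t + δ) (by linarith) (by rw [hδdef]; linarith) x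
  simpa only [add_sub_cancel_right] using key

/-- **Proposition 4 of Barker–Prange, in the form used here (via their Remark 5 and the KNSS
Liouville theorem).** A Type-I ancient mild field `U` on `(−∞, 0) × ℝ³` which, with a pressure
`P` and a weak gradient `H`, is a suitable weak solution on the backward slab with `𝐈 < ∞`, and
whose vorticity on ONE slice `s₀ < 0` is everywhere parallel to a fixed non-zero vector `e`, can
NOT have a backward singular point at the origin. Printed (HALF-SPACE, Prop. 4, p. 5): "Suppose
that `(ū, p̄)` is a mild solution to the Navier–Stokes equations on `ℝ³₊ × (−∞,0)` with
`ū|_{∂ℝ³₊} = 0`. … suppose `(ū, p̄)` is a suitable weak solution … on `ℝ³₊ × (−∞,0)`. Furthermore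
suppose that `|ū(x,t)| ≤ M/√(−t)` and `sup_{0<r<∞}{(1/r) sup_{−r²<t<0} ∫_{B⁺(r)}|ū|² + (1/r)
∫_{Q⁺(r)}|∇ū|² + (1/r²)∫_{Q⁺(r)}|p̄ − (p̄)_{B⁺(r)}|^{3/2}} ≤ M'`. … there exists `γ(M,M') > 0` such
that if `ω̄(x,−t₀)·e_i = 0` in `B⁺(γ(M,M')√t₀)` for `i = 2,3` and some `t₀ ∈ (0,∞)` then
`(x,t) = (0,0)` is a regular point for `ū`"; typed here in the WHOLE SPACE (deviation (D1): no
boundary, no no-slip condition, balls `B` for `B⁺`, and the hypothesis already global in space),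
the conclusion drawn through Remark 5 (p. 5): slice lemma (the printed "`Δu₁^(∞) = 0` … By the
classical Liouville theorem for the Laplace equation, we infer `u₁^(∞) ≡ 0`" step, p. 15) ⇒
`U(s₀)` is invariant under the
translations along `e`; forward propagation (`IsTypeIAncientMild.comp_add_eq_after`); a second
zoom at the origin (`LocalTypeIBlowup.exists_typeIAncientMild_zoomLimit`: the limit is Type-I
ancient mild, `e`-invariant at all times, and singular at the origin by persistence); rotation of
`e` to the axis `e₁`; KNSS 2009, proof of Thm. 6.2 (`KNSS2009_typeI_rate_liouville_holds`) on
the time-shifted copies: the second limit vanishes identically, which contradicts its singular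
origin. [cite: BarkerPrange2020Alignment, Prop. 4 and Remark 5 (arXiv:1906.08225 p. 5), proof of Prop. 4 Step 3 (p. 15); KochNadirashviliSereginSverak2009, Thm 5.1, Remark 6.1 and proof of Thm 6.2 (arXiv p. 13)] -/
theorem not_isBackwardSingularPoint_of_typeIAncientMild_of_curl_parallel_slice
    {M : ℝ} {U : ℝ → (EuclideanSpace ℝ (Fin 3)) → (EuclideanSpace ℝ (Fin 3))}
    {P : ℝ → (EuclideanSpace ℝ (Fin 3)) → ℝ}
    {H : ℝ → (EuclideanSpace ℝ (Fin 3)) → (EuclideanSpace ℝ (Fin 3)) →L[ℝ] (EuclideanSpace ℝ (Fin 3))}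
    (hU : IsTypeIAncientMild M U)
    (hsw : IsSuitableWeakSolutionOn (slab (EuclideanSpace ℝ (Fin 3)) (Iio 0) isOpen_Iio) 1 0 U P)
    (hwg : HasWeakSpatialGradientOn (slab (EuclideanSpace ℝ (Fin 3)) (Iio 0) isOpen_Iio) U H)
    (hI : typeIBound (Iio (0 : ℝ) ×ˢ univ) U P H < ⊤)
    {s₀ : ℝ} (hs₀ : s₀ < 0) {e : EuclideanSpace ℝ (Fin 3)} (he : e ≠ 0)
    (hpar : ∀ y, ∃ a : ℝ, curl (U s₀) y = a • e) :
    ¬ IsBackwardSingularPoint U 0 := by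
  intro hsing
  have hM : 0 ≤ M := hU.nonneg
  -- ## Step A: the slice `U s₀` is invariant under translations along `e` (slice lemma)
  have hinv₀ : ∀ x (r : ℝ), U s₀ (x + r • e) = U s₀ x := fun x r =>
    translationInvariant_of_curl_parallel ((hU.contDiff_slice hs₀).of_le (by norm_cast))
      (hU.isDivFree hs₀) ⟨M / Real.sqrt (-s₀), fun x => hU.norm_le hs₀ x⟩ he hpar x r
  -- ## Step B: invariance at all later times
  have hinv : ∀ t, s₀ ≤ t → t < 0 → ∀ x (r : ℝ), U t (x + r • e) = U t x := by
    intro t hst ht x r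
    rcases hst.eq_or_lt with h | h
    · subst h
      exact hinv₀ x r
    · exact hU.comp_add_eq_after hs₀ (fun x => hinv₀ x r) t h ht x
  -- ## Step C: the second zoom, at the singular origin, along the scales `1/(n+1)`
  set P' : ℝ → (EuclideanSpace ℝ (Fin 3)) → ℝ :=
    fun t x => P t x - ⨍ y in ball (0 : EuclideanSpace ℝ (Fin 3)) 1, P t y with hP'
  have hsw' : IsSuitableWeakSolutionOn (slab (EuclideanSpace ℝ (Fin 3)) (Iio 0) isOpen_Iio) 1 0 U P' :=
    hsw.sub_unitBallMean_slab
  have hI' : typeIBound (Iio (0 : ℝ) ×ˢ univ) U P' H < ⊤ := by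
    have e1 := typeIBound_sub_unitBallMean (u := U) (G := H) hsw.distributional.2.2.1
    rw [hP', e1]
    exact hI
  have h0 : ∀ t, ⨍ y in ball (0 : EuclideanSpace ℝ (Fin 3)) 1, P' t y = 0 := fun t =>
    unitBallMean_sub_unitBallMean P t
  have hball1 : IsSuitableWeakSolutionInBall 1 0 U P' :=
    isSuitableWeakSolutionInBall_of_slab hsw' hwg hI'.ne h0 le_rfl
  have hQslab : parabolicCylinder 1 (0 : ℝ × (EuclideanSpace ℝ (Fin 3))) ⊆ Iio 0 ×ˢ univ :=
    parabolicCylinder_origin_subset_slab 1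
  have hwg1 : HasWeakSpatialGradientOn (parabolicCylinderOpens 1 (0 : ℝ × (EuclideanSpace ℝ (Fin 3)))) U H :=
    hwg.mono (fun w hw => hQslab hw)
  have hI1 : typeIBound (parabolicCylinder 1 (0 : ℝ × (EuclideanSpace ℝ (Fin 3)))) U P' H < ⊤ :=
    lt_of_le_of_lt (typeIBound_mono hQslab) hI'
  have hcont1 : ContinuousOn (uncurry U) (parabolicCylinder 1 (0 : ℝ × (EuclideanSpace ℝ (Fin 3)))) :=
    hU.continuousOn_uncurry.mono hQslab
  have hrate1 : ∀ (t : ℝ) (x : EuclideanSpace ℝ (Fin 3)),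
      (t, x) ∈ parabolicCylinder 1 (0 : ℝ × (EuclideanSpace ℝ (Fin 3))) →
        ‖U t x‖ ≤ M / Real.sqrt ((0 : ℝ × (EuclideanSpace ℝ (Fin 3))).1 - t) := by
    intro t x htx
    have ht : t < 0 := by
      rw [mem_parabolicCylinder] at htx
      simpa using htx.1.2
    rw [Prod.fst_zero, zero_sub]
    exact hU.norm_le ht x
  obtain ⟨φ, hφ, Ub, Pb, Hb, hUb, -, -, -, hsingb, hconvb, -⟩ :=
    exists_typeIAncientMild_zoomLimit one_pos hball1 hwg1 hI1 hcont1 hrate1 hsing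
      (R := fun n : ℕ => 1 / ((n : ℝ) + 1)) (fun n => by positivity) tendsto_one_div_add_atTop_nhds_zero_nat
  -- ## Step D: the second limit is invariant along `e` at all times
  have hR0 : Tendsto (fun j => 1 / ((φ j : ℝ) + 1)) atTop (𝓝 0) :=
    tendsto_one_div_add_atTop_nhds_zero_nat.comp hφ.tendsto_atTop
  have hinvb₁ : ∀ s < (-1 : ℝ), ∀ y (r : ℝ), Ub s (y + r • e) = Ub s y := by
    intro s hs y r
    have h1 := hconvb s hs (y + r • e)
    have h2 := hconvb s hs y
    refine tendsto_nhds_unique h1 (h2.congr' ?_)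
    have hev : ∀ᶠ j in atTop, s₀ < (1 / ((φ j : ℝ) + 1)) ^ 2 * s := by
      have h3 : Tendsto (fun j => (1 / ((φ j : ℝ) + 1)) ^ 2 * s) atTop (𝓝 ((0 : ℝ) ^ 2 * s)) :=
        (hR0.pow 2).mul_const s
      rw [zero_pow two_ne_zero, zero_mul] at h3
      exact h3.eventually (lt_mem_nhds hs₀)
    filter_upwards [hev] with j hj
    have hneg : (1 / ((φ j : ℝ) + 1)) ^ 2 * s < 0 := mul_neg_of_pos_of_neg (by positivity) (by linarith)
    simp only [Prod.fst_zero, Prod.snd_zero, zero_add, smul_add, smul_smul]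
    rw [hinv _ hj.le hneg]
  have hinvb : ∀ t < (0 : ℝ), ∀ y (r : ℝ), Ub t (y + r • e) = Ub t y := by
    intro t ht y r
    by_cases h2 : t < -1
    · exact hinvb₁ t h2 y r
    · push Not at h2
      exact hUb.comp_add_eq_after (by norm_num : (-2 : ℝ) < 0) (fun x => hinvb₁ (-2) (by norm_num) x r) t
        (by linarith) ht y
  -- ## Step E: rotate `e` to the axis `e₁` and apply the KNSS Liouville theorem to shifted copies
  set a : EuclideanSpace ℝ (Fin 3) := ‖e‖⁻¹ • e with ha
  have ha1 : ‖a‖ = 1 := by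
    rw [ha, norm_smul, norm_inv, norm_norm, inv_mul_cancel₀ (norm_ne_zero_iff.2 he)]
  obtain ⟨Rot, hRot⟩ := exists_linearIsometryEquiv_map_single_one ha1
  have hzero : ∀ δ : ℝ, 0 < δ → ∀ t < (0 : ℝ), ∀ x, Ub (t - δ) x = 0 := by
    intro δ hδ
    have hV := hUb.comp_sub_right hδ.le
    set W : ℝ → (EuclideanSpace ℝ (Fin 3)) → (EuclideanSpace ℝ (Fin 3)) :=
      fun t y => Rot.symm (Ub (t - δ) (Rot y)) with hW
    have hWc : ContinuousOn (uncurry W) (Iio 0 ×ˢ univ) := by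
      have e1 : uncurry W = Rot.symm ∘ uncurry (fun t => Ub (t - δ)) ∘
          fun q : ℝ × (EuclideanSpace ℝ (Fin 3)) => (q.1, Rot q.2) := by
        funext q
        rfl
      rw [e1]
      refine Rot.symm.continuous.comp_continuousOn (hV.continuousOn_uncurry.comp
        (continuous_fst.prodMk (Rot.continuous.comp continuous_snd)).continuousOn ?_)
      intro q hq
      exact ⟨hq.1, mem_univ _⟩
    obtain ⟨K, hK⟩ := hUb.isBoundedOn hδ
    have hWbd : ∃ K : ℝ, ∀ t < 0, ∀ x, ‖W t x‖ ≤ K :=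
      ⟨K, fun t ht x => by
        show ‖Rot.symm (Ub (t - δ) (Rot x))‖ ≤ K
        rw [LinearIsometryEquiv.norm_map]
        exact hK (t - δ) (by simp only [mem_Iio]; linarith) (Rot x)⟩
    have hWdiv : ∀ t < 0, IsWeaklyDivFree (W t) := by
      intro t ht
      have h1 := (hV.isWeaklyDivFree ht).conj_linearIsometryEquiv Rot.symm
      simpa only [LinearIsometryEquiv.symm_symm] using h1
    have hWmild : ∀ s t : ℝ, s < t → t < 0 → ∀ x,
        W t x = UnboundedOperators.heatExtension (W s) (t - s) x - oseenDuhamel 1 s W W t x := by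
      intro s t hst ht x
      have key := hV.mild_eq_heatExtension hst ht (Rot x)
      show Rot.symm (Ub (t - δ) (Rot x)) = _
      have key' : Ub (t - δ) (Rot x) = UnboundedOperators.heatExtension (fun y => Ub (s - δ) y) (t - s) (Rot x) -
          oseenDuhamel 1 s (fun τ => Ub (τ - δ)) (fun τ => Ub (τ - δ)) t (Rot x) := key
      rw [key', map_sub]
      congr 1
      · have h2 := heatExtension_conj_linearIsometryEquiv Rot.symm (fun y => Ub (s - δ) y) (t - s) x
        simp only [LinearIsometryEquiv.symm_symm] at h2
        exact h2.symm
      · exact (oseenDuhamel_symm_conj_linearIsometryEquiv Rot 1 s (fun τ => Ub (τ - δ))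
          (fun τ => Ub (τ - δ)) t x).symm
    have hWinv : ∀ t < 0, ∀ (x : EuclideanSpace ℝ (Fin 3)) (d : ℝ),
        W t (x + EuclideanSpace.single 1 d) = W t x := by
      intro t ht x d
      show Rot.symm (Ub (t - δ) (Rot (x + EuclideanSpace.single 1 d))) = Rot.symm (Ub (t - δ) (Rot x))
      have hsingle : (EuclideanSpace.single (1 : Fin 3) d : EuclideanSpace ℝ (Fin 3)) =
          d • EuclideanSpace.single (1 : Fin 3) (1 : ℝ) := by
        ext j
        simp
      rw [map_add, hsingle, map_smul, hRot, ha, smul_smul, hinvb (t - δ) (by linarith) (Rot x) (d * ‖e‖⁻¹)]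
    have hWrate : ∀ t < 0, ∀ x, Real.sqrt (-t) * ‖W t x‖ ≤ M := by
      intro t ht x
      show Real.sqrt (-t) * ‖Rot.symm (Ub (t - δ) (Rot x))‖ ≤ M
      rw [LinearIsometryEquiv.norm_map]
      have h1 := hUb.norm_le (by linarith : t - δ < 0) (Rot x)
      have hs1 : 0 < Real.sqrt (-(t - δ)) := Real.sqrt_pos.2 (by linarith)
      have hs2 : Real.sqrt (-t) ≤ Real.sqrt (-(t - δ)) := Real.sqrt_le_sqrt (by linarith)
      have hq : 0 ≤ M / Real.sqrt (-(t - δ)) := div_nonneg hM hs1.le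
      calc Real.sqrt (-t) * ‖Ub (t - δ) (Rot x)‖
          ≤ Real.sqrt (-t) * (M / Real.sqrt (-(t - δ))) := by gcongr
        _ ≤ Real.sqrt (-(t - δ)) * (M / Real.sqrt (-(t - δ))) := by gcongr
        _ = M := by field_simp
    have hW0 := KNSS2009_typeI_rate_liouville_holds hWc hWbd hWdiv hWmild hWinv hWrate
    intro t ht x
    have h1 := hW0 t ht (Rot.symm x)
    have h1' : Rot.symm (Ub (t - δ) (Rot (Rot.symm x))) = 0 := h1
    rw [LinearIsometryEquiv.apply_symm_apply] at h1'
    exact Rot.symm.injective (by rw [h1', map_zero])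
  have hUb0 : ∀ t < (0 : ℝ), ∀ x, Ub t x = 0 := by
    intro t ht x
    have h := hzero (-t / 2) (by linarith) (t / 2) (by linarith) x
    rwa [show t / 2 - -t / 2 = t by ring] at h
  -- ## Step F: contradiction with the singular origin of the second limit
  have hnorm : eLpNorm (uncurry Ub) ⊤
      (volume.restrict (parabolicCylinder 1 (0 : ℝ × (EuclideanSpace ℝ (Fin 3))))) = 0 := by
    rw [eLpNorm_congr_ae (g := 0) ?_, eLpNorm_zero]
    filter_upwards [ae_restrict_mem (isOpen_parabolicCylinder _ _).measurableSet] with w hw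
    have hw0 : w.1 < 0 := by
      rw [mem_parabolicCylinder] at hw
      simpa using hw.1.2
    exact hUb0 w.1 hw0 w.2
  have htop := hsingb 1 one_pos
  rw [hnorm] at htop
  exact ENNReal.zero_ne_top htop

/-! ### Step 4: the slice alignment hypothesis passes to the blow-up limit -/

/-- **Slice alignment along the zoom forces one vorticity direction on the limit slice**
(Barker–Prange 2020, proof of Thm. 1, Step 4, pp. 16–17: "for any `x` and `y` in `S⁺` there
exists `n` large enough such that `|ξ⁽ⁿ⁾(x,−t₀) − ξ⁽ⁿ⁾(y,−t₀)| ≤ Cη(R⁽ⁿ⁾|x−y|) → 0`. … Thus,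
the vorticity direction for `ω^(∞)(·,−t₀)` points in one direction in `B⁺(γ(M,M')√t₀)`", after
Giga–Miura 2011). Let the slice
alignment `SliceAligned ν T u x₀ δ d η (s n)` hold at the times `s n`, and let the rescaled
vorticities `a n • curl u(s n)(x₀ + L n • y)` converge to `Ω y` for every `y`, with factors
`a n, L n > 0` tending to `0` and `L n · r ≤ δ√(ν(T − s n))` (the rescaled ball of radius `r` lies
in the concentrating ball). Then `Ω` has the same direction at any two points of `B(0, r)` where it
does not vanish (there `|curl u| → ∞ > d` eventually, and the modulus is evaluated at distances
`L n ‖y − y'‖ → 0`). [cite: BarkerPrange2020Alignment, proof of Thm. 1 Step 4 (arXiv:1906.08225 pp. 16–17); GigaMiura2011, proof of Prop. 2.2 step 1] -/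
theorem dir_eq_of_sliceAligned_along
    {u : ℝ → (EuclideanSpace ℝ (Fin 3)) → (EuclideanSpace ℝ (Fin 3))} {ν T δ d : ℝ} {η : ℝ → ℝ}
    {x₀ : EuclideanSpace ℝ (Fin 3)} {s : ℕ → ℝ}
    (hη : Continuous η) (hη0 : η 0 = 0)
    (hal : ∀ n, BarkerPrange2020.SliceAligned ν T u x₀ δ d η (s n))
    {a L : ℕ → ℝ} {r : ℝ} (ha : ∀ n, 0 < a n) (ha0 : Tendsto a atTop (𝓝 0))
    (hL : ∀ n, 0 < L n) (hL0 : Tendsto L atTop (𝓝 0))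
    (hLr : ∀ n, L n * r ≤ δ * Real.sqrt (ν * (T - s n)))
    {Ω : (EuclideanSpace ℝ (Fin 3)) → (EuclideanSpace ℝ (Fin 3))}
    (hconv : ∀ y, Tendsto (fun n => a n • curl (u (s n)) (x₀ + L n • y)) atTop (𝓝 (Ω y))) :
    ∀ y ∈ ball (0 : EuclideanSpace ℝ (Fin 3)) r, ∀ y' ∈ ball (0 : EuclideanSpace ℝ (Fin 3)) r,
      Ω y ≠ 0 → Ω y' ≠ 0 → ‖Ω y‖⁻¹ • Ω y = ‖Ω y'‖⁻¹ • Ω y' := by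
  intro y hy y' hy' hΩy hΩy'
  set Pt : ℕ → EuclideanSpace ℝ (Fin 3) := fun n => x₀ + L n • y with hPt
  set Pt' : ℕ → EuclideanSpace ℝ (Fin 3) := fun n => x₀ + L n • y' with hPt'
  set A : ℕ → EuclideanSpace ℝ (Fin 3) := fun n => curl (u (s n)) (Pt n) with hA
  set B : ℕ → EuclideanSpace ℝ (Fin 3) := fun n => curl (u (s n)) (Pt' n) with hB
  have hcA : Tendsto (fun n => a n • A n) atTop (𝓝 (Ω y)) := hconv y
  have hcB : Tendsto (fun n => a n • B n) atTop (𝓝 (Ω y')) := hconv y'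
  -- the rescaled points lie in the concentrating balls
  have hmem : ∀ z : EuclideanSpace ℝ (Fin 3), z ∈ ball (0 : EuclideanSpace ℝ (Fin 3)) r → ∀ n,
      x₀ + L n • z ∈ ball x₀ (δ * Real.sqrt (ν * (T - s n))) := by
    intro z hz n
    rw [mem_ball, dist_eq_norm, add_sub_cancel_left, norm_smul, Real.norm_of_nonneg (hL n).le]
    calc L n * ‖z‖ < L n * r := mul_lt_mul_of_pos_left (mem_ball_zero_iff.1 hz) (hL n)
      _ ≤ _ := hLr n
  -- normalisation is continuous at non-zero limits and invariant under positive scaling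
  have hdir : ∀ (v : ℕ → EuclideanSpace ℝ (Fin 3)) (z : EuclideanSpace ℝ (Fin 3)), z ≠ 0 →
      Tendsto (fun n => a n • v n) atTop (𝓝 z) →
      Tendsto (fun n => ‖v n‖⁻¹ • v n) atTop (𝓝 (‖z‖⁻¹ • z)) := by
    intro v z hz hv
    have h1 : Tendsto (fun n => ‖a n • v n‖⁻¹ • (a n • v n)) atTop (𝓝 (‖z‖⁻¹ • z)) :=
      ((hv.norm).inv₀ (norm_ne_zero_iff.mpr hz)).smul hv
    refine h1.congr fun n => ?_
    rw [norm_smul, Real.norm_of_nonneg (ha n).le, mul_inv, smul_smul, mul_comm (a n)⁻¹, mul_assoc,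
      inv_mul_cancel₀ (ha n).ne', mul_one]
  -- the vorticity magnitudes blow up along the zoom, hence exceed `d` eventually
  have hlarge : ∀ (v : ℕ → EuclideanSpace ℝ (Fin 3)) (z : EuclideanSpace ℝ (Fin 3)), z ≠ 0 →
      Tendsto (fun n => a n • v n) atTop (𝓝 z) → ∀ᶠ n in atTop, d < ‖v n‖ := by
    intro v z hz hv
    have hinv : Tendsto (fun n => (a n)⁻¹) atTop atTop :=
      tendsto_inv_nhdsGT_zero.comp (tendsto_nhdsWithin_iff.2 ⟨ha0, Eventually.of_forall fun n => ha n⟩)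
    have hn : Tendsto (fun n => ‖a n • v n‖) atTop (𝓝 ‖z‖) := hv.norm
    have hprod : Tendsto (fun n => (a n)⁻¹ * ‖a n • v n‖) atTop atTop :=
      hinv.atTop_mul_pos (norm_pos_iff.2 hz) hn
    have heq : ∀ n, (a n)⁻¹ * ‖a n • v n‖ = ‖v n‖ := fun n => by
      rw [norm_smul, Real.norm_of_nonneg (ha n).le, ← mul_assoc, inv_mul_cancel₀ (ha n).ne', one_mul]
    simp_rw [heq] at hprod
    exact hprod.eventually_gt_atTop d
  -- the chord of the two directions tends both to the chord of the limits and to `0`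
  set F : ℕ → EuclideanSpace ℝ (Fin 3) := fun n => ‖A n‖⁻¹ • A n - ‖B n‖⁻¹ • B n with hF
  have hF1 : Tendsto F atTop (𝓝 (‖Ω y‖⁻¹ • Ω y - ‖Ω y'‖⁻¹ • Ω y')) :=
    (hdir A _ hΩy hcA).sub (hdir B _ hΩy' hcB)
  have hF2 : Tendsto F atTop (𝓝 0) := by
    have hηL : Tendsto (fun n => η (L n * ‖y - y'‖)) atTop (𝓝 0) := by
      have h1 : Tendsto (fun n => L n * ‖y - y'‖) atTop (𝓝 0) := by
        simpa using hL0.mul_const ‖y - y'‖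
      have h2 := (hη.tendsto 0).comp h1
      rwa [hη0] at h2
    refine squeeze_zero_norm' ?_ hηL
    filter_upwards [hlarge A _ hΩy hcA, hlarge B _ hΩy' hcB] with n hnA hnB
    have h := hal n (Pt n) (Pt' n) (hmem y hy n) (hmem y' hy' n) hnA hnB
    have hdist : ‖Pt n - Pt' n‖ = L n * ‖y - y'‖ := by
      simp only [hPt, hPt', add_sub_add_left_eq_sub, ← smul_sub, norm_smul, Real.norm_of_nonneg (hL n).le]
    simpa only [vorticityDirection, hdist] using h
  exact sub_eq_zero.1 (tendsto_nhds_unique hF1 hF2)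

/-! ### Steps 1–3 at unit viscosity: the zoom at the singular vertex along the given times -/

/-- **`L^∞` norms under an amplitude-`a` space–time affine pull-back** (`β, γ > 0`, any centre):
`‖a · u ∘ Φ‖_{L^∞(Φ⁻¹ S)} = a ‖u‖_{L^∞(S)}` (the tree's `eLpNorm_top_nsZoom` is the parabolic case
`β = c²`, `γ = c`, `a = c`; same proof). [folklore] -/
private theorem eLpNorm_top_smul_stPull_preimage {a β γ : ℝ} (ha : 0 ≤ a) (hβ : 0 < β)
    (hγ : 0 < γ) (t₀ : ℝ) (x₀ : EuclideanSpace ℝ (Fin 3)) (S : Set (ℝ × (EuclideanSpace ℝ (Fin 3))))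
    (u : ℝ → (EuclideanSpace ℝ (Fin 3)) → (EuclideanSpace ℝ (Fin 3))) :
    eLpNorm (uncurry (a • stPull β γ t₀ x₀ u)) ∞
        (volume.restrict (stAffine β γ t₀ x₀ ⁻¹' S)) =
      ENNReal.ofReal a * eLpNorm (uncurry u) ∞ (volume.restrict S) := by
  have hme := measurableEmbedding_stAffine (E := EuclideanSpace ℝ (Fin 3)) hβ.ne' hγ.ne' t₀ x₀
  rw [eLpNorm_exponent_top, eLpNorm_exponent_top, eLpNormEssSup_eq_essSup_enorm,
    eLpNormEssSup_eq_essSup_enorm]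
  have hF : (fun w : ℝ × (EuclideanSpace ℝ (Fin 3)) => ‖uncurry (a • stPull β γ t₀ x₀ u) w‖ₑ) =
      fun w => ENNReal.ofReal a *
        ((fun w' : ℝ × (EuclideanSpace ℝ (Fin 3)) => ‖uncurry u w'‖ₑ) ∘ stAffine β γ t₀ x₀) w := by
    funext w
    rcases w with ⟨s, y⟩
    simp only [uncurry_apply_pair, Pi.smul_apply, stPull_apply, enorm_smul, Real.enorm_eq_ofReal ha,
      Function.comp_apply, stAffine_apply]
  rw [hF, ENNReal.essSup_const_mul]
  congr 1
  have h2 := hme.essSup_map_measure (μ := volume.restrict (stAffine β γ t₀ x₀ ⁻¹' S))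
    (g := fun w' : ℝ × (EuclideanSpace ℝ (Fin 3)) => ‖uncurry u w'‖ₑ)
  rw [map_stAffine_volume_restrict_preimage hβ hγ, finrank_euclideanSpace_fin,
    essSup_ennreal_smul_measure (by simp; positivity)] at h2
  exact h2.symm

/-- **Steps 1–3 of Barker–Prange's proof at unit viscosity.** Let `(u, p)` be a classical
Leray–Hopf solution on `[0, T)` (`ν = 1`) with the global Type-I bound `‖u(t,x)‖ ≤ M/√(T − t)`,
let `(T, x₀)` be a backward singular point and `s n → T` times in `(0, T)`. Step 1 (p. 16): the
gauged pair is a suitable weak solution in the parabolic balls at the vertex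
(`SereginSverak2002.isSuitableWeakSolutionInBall_vertex`) and the rate gives `𝐈 < ∞` near the
vertex (Thm. 2 / `albrittonBarker2019_lemma_2_5_rate_holds`); Steps 2–3 (pp. 16–17): the zoom at
`(T, x₀)` with the scales `√(T − s n)/2` (the printed `R⁽ⁿ⁾ = √(T − t⁽ⁿ⁾)` up to the factor
placing the slice `t⁽ⁿ⁾` at the rescaled time `−4`) has, along a subsequence `φ`, a Type-I ancient
mild limit `U`, suitable with `𝐈 < ∞` on the backward slab and SINGULAR at the origin
(`LocalTypeIBlowup.exists_typeIAncientMild_zoomLimit`), with the rescaled vorticities of the slices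
`s (φ j)` converging to the vorticity of the limit slice `U(−4)`:
`((T − s)/4) curl u(s)(x₀ + (√(T − s)/2) y) → curl U(−4)(y)`.
[cite: BarkerPrange2020Alignment, §4 proof of Thm. 1 Steps 1–3 (arXiv:1906.08225 pp. 16–17) and Thm. 3 (p. 18); AlbrittonBarker2019, Lemma 2.5] -/
theorem exists_zoomLimit_at_singular_along
    {T M : ℝ} {u : ℝ → (EuclideanSpace ℝ (Fin 3)) → (EuclideanSpace ℝ (Fin 3))}
    {p : ℝ → (EuclideanSpace ℝ (Fin 3)) → ℝ} (hT : 0 < T)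
    (hcl : IsClassicalNSSolutionOn (Ico 0 T) 1 0 u p) (hLH : IsLerayHopfOn T 1 0 (u 0) u)
    (hI : ∀ t ∈ Ioo 0 T, ∀ x : EuclideanSpace ℝ (Fin 3), ‖u t x‖ ≤ M / Real.sqrt (T - t))
    {x₀ : EuclideanSpace ℝ (Fin 3)} (hsing : IsBackwardSingularPoint u (T, x₀))
    {s : ℕ → ℝ} (hs : ∀ n, s n ∈ Ioo 0 T) (hsT : Tendsto s atTop (𝓝 T)) :
    ∃ φ : ℕ → ℕ, StrictMono φ ∧
      ∃ (U : ℝ → (EuclideanSpace ℝ (Fin 3)) → (EuclideanSpace ℝ (Fin 3)))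
        (P : ℝ → (EuclideanSpace ℝ (Fin 3)) → ℝ)
        (H : ℝ → (EuclideanSpace ℝ (Fin 3)) → (EuclideanSpace ℝ (Fin 3)) →L[ℝ] (EuclideanSpace ℝ (Fin 3))),
        IsTypeIAncientMild M U ∧
        IsSuitableWeakSolutionOn (slab (EuclideanSpace ℝ (Fin 3)) (Iio 0) isOpen_Iio) 1 0 U P ∧
        HasWeakSpatialGradientOn (slab (EuclideanSpace ℝ (Fin 3)) (Iio 0) isOpen_Iio) U H ∧
        typeIBound (Iio (0 : ℝ) ×ˢ univ) U P H < ⊤ ∧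
        IsBackwardSingularPoint U 0 ∧
        ∀ y : EuclideanSpace ℝ (Fin 3),
          Tendsto (fun j => ((T - s (φ j)) / 4) • curl (u (s (φ j))) (x₀ + (Real.sqrt (T - s (φ j)) / 2) • y))
            atTop (𝓝 (curl (U (-4)) y)) := by
  -- ## Step 1: the class at the vertex and `𝐈 < ∞` from the rate
  set ρ : ℝ := Real.sqrt T / 2 with hρdef
  have hρ : 0 < ρ := by rw [hρdef]; positivity
  have hρ2 : ρ ^ 2 = T / 4 := by
    rw [hρdef, div_pow, Real.sq_sqrt hT.le]; norm_num
  have hρT : ρ ^ 2 ≤ T := by rw [hρ2]; linarith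
  set pg : ℝ → (EuclideanSpace ℝ (Fin 3)) → ℝ := fun t x => p t x - (p t 0 - normalisedPressure (u t) 0) with hpg
  have hballρ : IsSuitableWeakSolutionInBall ρ ((T, x₀) : ℝ × (EuclideanSpace ℝ (Fin 3))) u pg :=
    SereginSverak2002.isSuitableWeakSolutionInBall_vertex hT hcl hLH x₀ hρT
  -- zoom by `ρ` to the unit ball
  set ut : ℝ → (EuclideanSpace ℝ (Fin 3)) → (EuclideanSpace ℝ (Fin 3)) := ρ • stPull (ρ ^ 2) ρ T x₀ u with hut
  set pt : ℝ → (EuclideanSpace ℝ (Fin 3)) → ℝ := ρ ^ 2 • stPull (ρ ^ 2) ρ T x₀ pg with hpt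
  have hball1 : IsSuitableWeakSolutionInBall 1 (0 : ℝ × (EuclideanSpace ℝ (Fin 3))) ut pt := by
    have h := hballρ.zoom hρ
    simpa only using h
  obtain ⟨G₁, hG₁, -⟩ := hball1.2.2.1
  have hrate1 : ∀ t' x', (t', x') ∈ parabolicCylinder 1 (0 : ℝ × (EuclideanSpace ℝ (Fin 3))) →
      ‖ut t' x'‖ ≤ M / Real.sqrt ((0 : ℝ × (EuclideanSpace ℝ (Fin 3))).1 - t') := by
    intro t' x' hmem
    rw [mem_parabolicCylinder] at hmem
    simp only [Prod.fst_zero, Prod.snd_zero, zero_sub, one_pow, dist_zero_right] at hmem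
    obtain ⟨⟨ht1, ht0⟩, -⟩ := hmem
    have ht' : 0 < -t' := by linarith
    have hτ : T + ρ ^ 2 * t' ∈ Ioo 0 T := by
      rw [hρ2]
      constructor <;> nlinarith
    have h := hI _ hτ (x₀ + ρ • x')
    have hsq : Real.sqrt (T - (T + ρ ^ 2 * t')) = ρ * Real.sqrt (-t') := by
      rw [show T - (T + ρ ^ 2 * t') = ρ ^ 2 * (-t') by ring, Real.sqrt_mul (sq_nonneg _), Real.sqrt_sq hρ.le]
    rw [hsq] at h
    have hspos : 0 < Real.sqrt (-t') := Real.sqrt_pos.2 ht'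
    simp only [Prod.fst_zero, zero_sub]
    show ‖(ρ • stPull (ρ ^ 2) ρ T x₀ u) t' x'‖ ≤ M / Real.sqrt (-t')
    rw [smul_stPull_apply, norm_smul, Real.norm_of_nonneg hρ.le, le_div_iff₀ hspos]
    have h' := (le_div_iff₀ (mul_pos hρ hspos)).1 h
    calc ρ * ‖u (T + ρ ^ 2 * t') (x₀ + ρ • x')‖ * Real.sqrt (-t')
        = ‖u (T + ρ ^ 2 * t') (x₀ + ρ • x')‖ * (ρ * Real.sqrt (-t')) := by ring
      _ ≤ M := h'
  have hIhalf : typeIBound (parabolicCylinder (1 / 2) (0 : ℝ × (EuclideanSpace ℝ (Fin 3)))) ut pt G₁ < ⊤ :=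
    albrittonBarker2019_lemma_2_5_rate_holds 0 ut pt M hball1 hrate1 G₁ hG₁ (1 / 2) (by norm_num) (by norm_num)
  have hballh : IsSuitableWeakSolutionInBall (1 / 2) (0 : ℝ × (EuclideanSpace ℝ (Fin 3))) ut pt :=
    SuitableCompactness.isSuitableWeakSolutionInBall_of_le_radius hball1 (by norm_num) (by norm_num)
  have hle : parabolicCylinderOpens (1 / 2) (0 : ℝ × (EuclideanSpace ℝ (Fin 3))) ≤
      parabolicCylinderOpens 1 (0 : ℝ × (EuclideanSpace ℝ (Fin 3))) :=
    parabolicCylinder_mono (by norm_num) (by norm_num) _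
  have hwgh : HasWeakSpatialGradientOn (parabolicCylinderOpens (1 / 2) (0 : ℝ × (EuclideanSpace ℝ (Fin 3)))) ut G₁ :=
    hG₁.mono hle
  have hrateh : ∀ (t' : ℝ) (x' : EuclideanSpace ℝ (Fin 3)),
      (t', x') ∈ parabolicCylinder (1 / 2) (0 : ℝ × (EuclideanSpace ℝ (Fin 3))) →
        ‖ut t' x'‖ ≤ M / Real.sqrt ((0 : ℝ × (EuclideanSpace ℝ (Fin 3))).1 - t') :=
    fun t' x' h => hrate1 t' x' (hle h)
  -- continuity of the zoom on the half ball (the classical solution is smooth on `[0, T) × ℝ³`)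
  have hmaps : MapsTo (stAffine (ρ ^ 2) ρ T x₀)
      (parabolicCylinder (1 / 2) (0 : ℝ × (EuclideanSpace ℝ (Fin 3)))) (Ico 0 T ×ˢ univ) := by
    rintro ⟨t', x'⟩ hmem
    rw [mem_parabolicCylinder] at hmem
    simp only [Prod.fst_zero, Prod.snd_zero, zero_sub, dist_zero_right] at hmem
    obtain ⟨⟨ht1, ht0⟩, -⟩ := hmem
    rw [stAffine_apply]
    refine ⟨⟨?_, ?_⟩, mem_univ _⟩
    · rw [hρ2]; nlinarith
    · rw [hρ2]; nlinarith
  have hconth : ContinuousOn (uncurry ut) (parabolicCylinder (1 / 2) (0 : ℝ × (EuclideanSpace ℝ (Fin 3)))) := by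
    have e : uncurry ut = fun w => ρ • (uncurry u ∘ stAffine (ρ ^ 2) ρ T x₀) w := by
      funext w
      rfl
    rw [e]
    exact ContinuousOn.const_smul
      (hcl.smooth_velocity.continuousOn.comp (continuous_stAffine _ _ _ _).continuousOn hmaps) ρ
  -- the vertex stays singular
  have hst1 : stAffine (ρ ^ 2) ρ T x₀ (0 : ℝ × (EuclideanSpace ℝ (Fin 3))) =
      ((T, x₀) : ℝ × (EuclideanSpace ℝ (Fin 3))) := by
    rw [show (0 : ℝ × (EuclideanSpace ℝ (Fin 3))) = ((0 : ℝ), (0 : EuclideanSpace ℝ (Fin 3))) from rfl,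
      stAffine_apply, mul_zero, add_zero, smul_zero, add_zero]
  have hsing1 : IsBackwardSingularPoint ut 0 := by
    intro r hr
    rw [hut, eLpNorm_top_nsZoom hρ T x₀ r 0 u, hst1, hsing (ρ * r) (mul_pos hρ hr),
      ENNReal.mul_top (ENNReal.ofReal_pos.2 hρ).ne']
  -- ## Steps 2–3: the zoom along the scales `R n = √(T - s n) / (2ρ)`
  set R : ℕ → ℝ := fun n => Real.sqrt (T - s n) / (2 * ρ) with hRdef
  have hTs : ∀ n, 0 < T - s n := fun n => by linarith [(hs n).2]
  have hR : ∀ n, 0 < R n := fun n => by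
    rw [hRdef]
    exact div_pos (Real.sqrt_pos.2 (hTs n)) (by positivity)
  have hR0 : Tendsto R atTop (𝓝 0) := by
    have h1 : Tendsto (fun n => T - s n) atTop (𝓝 0) := by
      have h : Tendsto (fun n => T - s n) atTop (𝓝 (T - T)) := tendsto_const_nhds.sub hsT
      rwa [sub_self] at h
    have h2 : Tendsto (fun n => Real.sqrt (T - s n)) atTop (𝓝 0) := by
      have h := (Real.continuous_sqrt.tendsto 0).comp h1
      rwa [Function.comp_def, Real.sqrt_zero] at h
    have h3 := h2.div_const (2 * ρ)
    rwa [zero_div] at h3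
  obtain ⟨φ, hφ, U, P, H, hU, hswU, hwgU, hIU, hsingU, -, hcurl⟩ :=
    exists_typeIAncientMild_zoomLimit (z₀ := (0 : ℝ × (EuclideanSpace ℝ (Fin 3)))) (by norm_num : (0 : ℝ) < 1 / 2)
      hballh hwgh hIhalf hconth hrateh hsing1 hR hR0
  refine ⟨φ, hφ, U, P, H, hU, hswU, hwgU, hIU, hsingU, fun y => ?_⟩
  have h := hcurl (-4) (by norm_num) y
  refine h.congr fun j => ?_
  simp only [Prod.fst_zero, Prod.snd_zero, zero_add]
  show R (φ j) ^ 2 • curl ((ρ • stPull (ρ ^ 2) ρ T x₀ u) (R (φ j) ^ 2 * (-4))) (R (φ j) • y) = _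
  rw [curl_smul_stPull, smul_smul, smul_smul]
  have hRsq : R (φ j) ^ 2 = (T - s (φ j)) / (4 * ρ ^ 2) := by
    rw [hRdef]
    dsimp only
    rw [div_pow, Real.sq_sqrt (hTs (φ j)).le]
    ring
  have e1 : R (φ j) ^ 2 * (ρ * ρ) = (T - s (φ j)) / 4 := by
    rw [hRsq]
    field_simp
  have e2 : T + ρ ^ 2 * (R (φ j) ^ 2 * (-4)) = s (φ j) := by
    rw [hRsq]
    field_simp
    ring
  have e3 : ρ * R (φ j) = Real.sqrt (T - s (φ j)) / 2 := by
    rw [hRdef]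
    dsimp only
    field_simp
  rw [e1, e2, e3]

/-! ### Assembly: the named fact -/

/-- **Barker–Prange 2020, Theorem 3, PROVED** — discharge of the named fact
`barkerPrange2020_alignment_concentrating_typeI` (whole space; arXiv:1906.08225 §5 p. 18, (5.3) and
(5.4)), following the printed proof of Theorem 1 (§4) with the deviations (D1)–(D2) of the module
docstring: normalise `ν = 1`; Steps 1–3 `exists_zoomLimit_at_singular_along` (zoom at the
prescribed singular vertex along `R⁽ⁿ⁾ ~ √(T − t⁽ⁿ⁾)`, persistence of the singularity); Step 4 —
(5.4): `dir_eq_of_sliceAligned_along` gives one vorticity direction on the limit slice in the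
rescaled ball, (5.3): the rescaled vorticities tend to `0` there (§5.1); globalisation to `ℝ³` by
analyticity (`IsTypeIAncientMild.analyticOnNhd_slice_univ`, `curl_parallel_of_parallel_on_open`);
Step 5 — `not_isBackwardSingularPoint_of_typeIAncientMild_of_curl_parallel_slice` (Prop. 4 via
Remark 5 and the KNSS Liouville theorem). The printed `δ(M, u₀)` is witnessed by `δ = 1`
(deviation (D1): any `δ > 0` works). [cite: BarkerPrange2020Alignment, Thm. 3 ((5.3)–(5.4), arXiv:1906.08225 §5.2 p. 18) with §4 (proof of Thm. 1), Prop. 4 and Remark 5 (p. 5)] -/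
theorem barkerPrange2020_alignment_concentrating_typeI_holds :
    barkerPrange2020_alignment_concentrating_typeI := by
  intro ν T M hν hT u p hcl hLH _ hI
  refine ⟨1, one_pos, fun x₀ s hs _ hsT => ?_⟩
  -- ## ν-normalisation: `v(τ, x) = ν⁻¹ u(τ/ν, x)` on `[0, νT)` has unit viscosity
  set v : ℝ → (EuclideanSpace ℝ (Fin 3)) → (EuclideanSpace ℝ (Fin 3)) := timeRescale ν⁻¹ ν⁻¹ u with hvdef
  set q : ℝ → (EuclideanSpace ℝ (Fin 3)) → ℝ := timeRescale ν⁻¹ (ν⁻¹ ^ 2) p with hqdef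
  have hνT : 0 < ν * T := mul_pos hν hT
  have hvst : v = ν⁻¹ • stPull ν⁻¹ 1 0 0 u := by
    funext τ x
    simp only [hvdef, timeRescale_apply, smul_stPull_apply, zero_add, one_smul]
  have hv_apply : ∀ τ x, v τ x = ν⁻¹ • u (ν⁻¹ * τ) x := fun τ x => rfl
  have hcl' : IsClassicalNSSolutionOn (Ico 0 (ν * T)) 1 0 v q := by
    have hmaps : MapsTo (fun τ => ν⁻¹ * τ) (Ico 0 (ν * T)) (Ico 0 T) := by
      intro τ hτ
      refine ⟨by have := hτ.1; positivity, ?_⟩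
      rw [inv_mul_lt_iff₀ hν]
      exact hτ.2
    have h := hcl.viscosityRescale_set hν.ne' hmaps (uniqueDiffOn_Ico 0 (ν * T))
    rwa [timeRescale_zero_force] at h
  have hLH' : IsLerayHopfOn (ν * T) 1 0 (v 0) v := by
    have h := hLH.viscosityRescale (c := ν⁻¹) (inv_pos.2 hν)
    have e1 : T / ν⁻¹ = ν * T := by rw [div_inv_eq_mul, mul_comm]
    have e2 : ν⁻¹ * ν = 1 := inv_mul_cancel₀ hν.ne'
    have e3 : timeRescale ν⁻¹ (ν⁻¹ ^ 2) (0 : ℝ → (EuclideanSpace ℝ (Fin 3)) → (EuclideanSpace ℝ (Fin 3))) = 0 :=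
      timeRescale_zero_force _ _
    have e4 : ν⁻¹ • u 0 = v 0 := by
      funext x
      rw [hv_apply, mul_zero, Pi.smul_apply]
    rw [e1, e2, e3, e4] at h
    exact h
  have hI' : ∀ τ ∈ Ioo 0 (ν * T), ∀ x : EuclideanSpace ℝ (Fin 3),
      ‖v τ x‖ ≤ (M / Real.sqrt ν) / Real.sqrt (ν * T - τ) := by
    intro τ hτ x
    have hτ' : ν⁻¹ * τ ∈ Ioo 0 T := (inv_mul_mem_Ioo_iff hν).2 hτ
    have h := hI _ hτ' x
    have hsν : 0 < Real.sqrt ν := Real.sqrt_pos.2 hν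
    have hsd : 0 < Real.sqrt (ν * T - τ) := Real.sqrt_pos.2 (by linarith [hτ.2])
    have e : Real.sqrt (T - ν⁻¹ * τ) = Real.sqrt (ν * T - τ) / Real.sqrt ν := by
      rw [show T - ν⁻¹ * τ = (ν * T - τ) / ν by field_simp, Real.sqrt_div' _ hν.le]
    rw [e] at h
    rw [hv_apply, norm_smul, norm_inv, Real.norm_of_nonneg hν.le]
    have hM : 0 ≤ M := by
      have h0 : 0 < Real.sqrt (ν * T - τ) / Real.sqrt ν := div_pos hsd hsν
      by_contra hM
      push Not at hM
      linarith [norm_nonneg (u (ν⁻¹ * τ) x), div_neg_of_neg_of_pos hM h0]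
    have key : ν⁻¹ * (M / (Real.sqrt (ν * T - τ) / Real.sqrt ν)) = M / Real.sqrt ν / Real.sqrt (ν * T - τ) := by
      have hνs : Real.sqrt ν * Real.sqrt ν = ν := Real.mul_self_sqrt hν.le
      field_simp
      nlinarith [hνs]
    calc ν⁻¹ * ‖u (ν⁻¹ * τ) x‖ ≤ ν⁻¹ * (M / (Real.sqrt (ν * T - τ) / Real.sqrt ν)) := by gcongr
      _ = M / Real.sqrt ν / Real.sqrt (ν * T - τ) := key
  -- the singular point moves to `(νT, x₀)`
  have hsingv : IsBackwardSingularPoint u (T, x₀) →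
      IsBackwardSingularPoint v ((ν * T, x₀) : ℝ × (EuclideanSpace ℝ (Fin 3))) := by
    intro hsg r hr
    have hpre : stAffine ν⁻¹ 1 0 (0 : EuclideanSpace ℝ (Fin 3)) ⁻¹' (Ioo (T - r ^ 2 / ν) T ×ˢ ball x₀ r) =
        parabolicCylinder r ((ν * T, x₀) : ℝ × (EuclideanSpace ℝ (Fin 3))) := by
      rw [stAffine_preimage_cylinder (inv_pos.2 hν) one_pos, parabolicCylinder]
      have e1 : (T - r ^ 2 / ν - 0) / ν⁻¹ = ν * T - r ^ 2 := by
        field_simp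
        ring
      have e2 : (T - 0) / ν⁻¹ = ν * T := by rw [sub_zero, div_inv_eq_mul, mul_comm]
      rw [e1, e2, inv_one, sub_zero, one_smul, div_one]
    rw [hvst, ← hpre, eLpNorm_top_smul_stPull_preimage (inv_pos.2 hν).le (inv_pos.2 hν) one_pos]
    -- the set `(T - r²/ν, T) × B(x₀, r)` contains a backward ball at `(T, x₀)`
    set r₁ : ℝ := min r (r / Real.sqrt ν) with hr₁
    have hr₁ : 0 < r₁ := lt_min hr (div_pos hr (Real.sqrt_pos.2 hν))
    have hsub : parabolicCylinder r₁ ((T, x₀) : ℝ × (EuclideanSpace ℝ (Fin 3))) ⊆ Ioo (T - r ^ 2 / ν) T ×ˢ ball x₀ r := by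
      rintro ⟨t, x⟩ htx
      rw [mem_parabolicCylinder] at htx
      obtain ⟨⟨ht1, ht2⟩, hx⟩ := htx
      have h1 : r₁ ≤ r := min_le_left _ _
      have h2 : r₁ ^ 2 ≤ r ^ 2 / ν := by
        have h3 : r₁ ≤ r / Real.sqrt ν := min_le_right _ _
        have h4 : (r / Real.sqrt ν) ^ 2 = r ^ 2 / ν := by rw [div_pow, Real.sq_sqrt hν.le]
        rw [← h4]
        exact pow_le_pow_left₀ hr₁.le h3 2
      refine ⟨⟨by simp only at ht1; linarith, ht2⟩, ?_⟩
      rw [mem_ball]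
      exact lt_of_lt_of_le hx h1
    have htop : eLpNorm (uncurry u) ⊤ (volume.restrict (Ioo (T - r ^ 2 / ν) T ×ˢ ball x₀ r)) = ⊤ :=
      top_le_iff.1 ((hsg r₁ hr₁).symm.le.trans (eLpNorm_mono_measure _ (Measure.restrict_mono hsub le_rfl)))
    rw [htop, ENNReal.mul_top]
    simpa using hν
  -- vorticity of `v`: `curl v(τ) = ν⁻¹ curl u(τ/ν)`
  have hcurlv : ∀ τ x, curl (v τ) x = ν⁻¹ • curl (u (ν⁻¹ * τ)) x := by
    intro τ x
    rw [hvst, curl_smul_stPull, mul_one, zero_add, zero_add, one_smul]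
  -- the times `ν s n`
  set s' : ℕ → ℝ := fun n => ν * s n with hs'
  have hs'mem : ∀ n, s' n ∈ Ioo 0 (ν * T) := fun n =>
    ⟨mul_pos hν (hs n).1, mul_lt_mul_of_pos_left (hs n).2 hν⟩
  have hs'T : Tendsto s' atTop (𝓝 (ν * T)) := hsT.const_mul ν
  -- ## the common core: zoom limit at the singular vertex, and the two endings
  have core : IsBackwardSingularPoint u (T, x₀) →
      ∃ (M' : ℝ) (U : ℝ → (EuclideanSpace ℝ (Fin 3)) → (EuclideanSpace ℝ (Fin 3)))
        (P : ℝ → (EuclideanSpace ℝ (Fin 3)) → ℝ)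
        (H : ℝ → (EuclideanSpace ℝ (Fin 3)) → (EuclideanSpace ℝ (Fin 3)) →L[ℝ] (EuclideanSpace ℝ (Fin 3)))
        (φ : ℕ → ℕ), StrictMono φ ∧
        IsTypeIAncientMild M' U ∧
        IsSuitableWeakSolutionOn (slab (EuclideanSpace ℝ (Fin 3)) (Iio 0) isOpen_Iio) 1 0 U P ∧
        HasWeakSpatialGradientOn (slab (EuclideanSpace ℝ (Fin 3)) (Iio 0) isOpen_Iio) U H ∧
        typeIBound (Iio (0 : ℝ) ×ˢ univ) U P H < ⊤ ∧
        IsBackwardSingularPoint U 0 ∧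
        ∀ y : EuclideanSpace ℝ (Fin 3),
          Tendsto (fun j => ((T - s (φ j)) / 4) • curl (u (s (φ j)))
            (x₀ + (Real.sqrt (ν * (T - s (φ j))) / 2) • y)) atTop (𝓝 (curl (U (-4)) y)) := by
    intro hsg
    obtain ⟨φ, hφ, U, P, H, hU, hswU, hwgU, hIU, hsingU, hconv⟩ :=
      exists_zoomLimit_at_singular_along hνT hcl' hLH' hI' (hsingv hsg) hs'mem hs'T
    refine ⟨_, U, P, H, φ, hφ, hU, hswU, hwgU, hIU, hsingU, fun y => ?_⟩
    refine (hconv y).congr fun j => ?_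
    simp only [hs']
    rw [hcurlv, smul_smul, show ν⁻¹ * (ν * s (φ j)) = s (φ j) by field_simp,
      show ν * T - ν * s (φ j) = ν * (T - s (φ j)) by ring,
      show (ν * (T - s (φ j))) / 4 * ν⁻¹ = (T - s (φ j)) / 4 by field_simp]
  -- the ending shared by both branches: a direction `e ≠ 0` with `curl U(-4) ∥ e` on `B(0, 2)`
  have ending : ∀ {M' : ℝ} {U : ℝ → (EuclideanSpace ℝ (Fin 3)) → (EuclideanSpace ℝ (Fin 3))}
      {P : ℝ → (EuclideanSpace ℝ (Fin 3)) → ℝ}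
      {H : ℝ → (EuclideanSpace ℝ (Fin 3)) → (EuclideanSpace ℝ (Fin 3)) →L[ℝ] (EuclideanSpace ℝ (Fin 3))},
      IsTypeIAncientMild M' U →
      IsSuitableWeakSolutionOn (slab (EuclideanSpace ℝ (Fin 3)) (Iio 0) isOpen_Iio) 1 0 U P →
      HasWeakSpatialGradientOn (slab (EuclideanSpace ℝ (Fin 3)) (Iio 0) isOpen_Iio) U H →
      typeIBound (Iio (0 : ℝ) ×ˢ univ) U P H < ⊤ →
      IsBackwardSingularPoint U 0 →
      ∀ {e : EuclideanSpace ℝ (Fin 3)}, e ≠ 0 →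
      (∀ y ∈ ball (0 : EuclideanSpace ℝ (Fin 3)) 2, ∃ a : ℝ, curl (U (-4)) y = a • e) → False := by
    intro M' U P H hU hswU hwgU hIU hsingU e he hball
    have han : AnalyticOnNhd ℝ (U (-4)) univ := hU.analyticOnNhd_slice_univ (by norm_num)
    have hpar := curl_parallel_of_parallel_on_open han isOpen_ball ⟨0, mem_ball_self (by norm_num)⟩ hball
    exact not_isBackwardSingularPoint_of_typeIAncientMild_of_curl_parallel_slice hU hswU hwgU hIU
      (by norm_num : (-4 : ℝ) < 0) he hpar hsingU
  have he₀ : (EuclideanSpace.single (0 : Fin 3) (1 : ℝ) : EuclideanSpace ℝ (Fin 3)) ≠ 0 := by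
    intro h
    have := congrArg (fun w : EuclideanSpace ℝ (Fin 3) => w 0) h
    simp at this
  -- geometry of the rescaled points: `x₀ + (√(ν(T - s))/2) y` lies in the concentrating ball for `‖y‖ < 2`
  have hLr : ∀ n, Real.sqrt (ν * (T - s n)) / 2 * 2 ≤ 1 * Real.sqrt (ν * (T - s n)) := fun n => by
    rw [div_mul_cancel₀ _ two_ne_zero, one_mul]
  have hLpos : ∀ n, 0 < Real.sqrt (ν * (T - s n)) / 2 := fun n =>
    div_pos (Real.sqrt_pos.2 (mul_pos hν (by linarith [(hs n).2]))) two_pos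
  have hTs : ∀ n, 0 < T - s n := fun n => by linarith [(hs n).2]
  have hL0' : ∀ {φ : ℕ → ℕ}, StrictMono φ →
      Tendsto (fun j => Real.sqrt (ν * (T - s (φ j))) / 2) atTop (𝓝 0) := by
    intro φ hφ
    have h1 : Tendsto (fun j => ν * (T - s (φ j))) atTop (𝓝 0) := by
      have h : Tendsto (fun j => ν * (T - s (φ j))) atTop (𝓝 (ν * (T - T))) :=
        (tendsto_const_nhds.sub (hsT.comp hφ.tendsto_atTop)).const_mul ν
      rwa [sub_self, mul_zero] at h
    have h2 : Tendsto (fun j => Real.sqrt (ν * (T - s (φ j)))) atTop (𝓝 0) := by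
      have h := (Real.continuous_sqrt.tendsto 0).comp h1
      rwa [Function.comp_def, Real.sqrt_zero] at h
    have h3 := h2.div_const 2
    rwa [zero_div] at h3
  have ha0' : ∀ {φ : ℕ → ℕ}, StrictMono φ → Tendsto (fun j => (T - s (φ j)) / 4) atTop (𝓝 0) := by
    intro φ hφ
    have h : Tendsto (fun j => (T - s (φ j)) / 4) atTop (𝓝 ((T - T) / 4)) :=
      (tendsto_const_nhds.sub (hsT.comp hφ.tendsto_atTop)).div_const 4
    rwa [sub_self, zero_div] at h
  refine ⟨fun hK hsg => ?_, fun d η _ hη hη0 hal hsg => ?_⟩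
  · -- ## (5.3): bounded vorticity on the concentrating balls
    obtain ⟨K, hK⟩ := hK
    obtain ⟨M', U, P, H, φ, hφ, hU, hswU, hwgU, hIU, hsingU, hconv⟩ := core hsg
    refine ending hU hswU hwgU hIU hsingU he₀ fun y hy => ⟨0, ?_⟩
    rw [zero_smul]
    -- the rescaled vorticities tend to `0` on `B(0, 2)` (§5.1: `|Ω⁽ⁿ⁾(y, -t₀)| ≤ (R⁽ⁿ⁾)² K → 0`)
    have hpt : ∀ j, x₀ + (Real.sqrt (ν * (T - s (φ j))) / 2) • y ∈
        ball x₀ (1 * Real.sqrt (ν * (T - s (φ j)))) := by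
      intro j
      rw [mem_ball, dist_eq_norm, add_sub_cancel_left, norm_smul, Real.norm_of_nonneg (hLpos (φ j)).le]
      calc Real.sqrt (ν * (T - s (φ j))) / 2 * ‖y‖ < Real.sqrt (ν * (T - s (φ j))) / 2 * 2 :=
            mul_lt_mul_of_pos_left (mem_ball_zero_iff.1 hy) (hLpos (φ j))
        _ ≤ 1 * Real.sqrt (ν * (T - s (φ j))) := hLr (φ j)
    have hzero : Tendsto (fun j => ((T - s (φ j)) / 4) • curl (u (s (φ j)))
        (x₀ + (Real.sqrt (ν * (T - s (φ j))) / 2) • y)) atTop (𝓝 0) := by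
      refine squeeze_zero_norm (a := fun j => (T - s (φ j)) / 4 * K) (fun j => ?_) ?_
      · have hnn : 0 ≤ (T - s (φ j)) / 4 := by have := hTs (φ j); positivity
        rw [norm_smul, Real.norm_of_nonneg hnn]
        exact mul_le_mul_of_nonneg_left (hK (φ j) _ (hpt j)) hnn
      · have h := (ha0' hφ).mul_const K
        rwa [zero_mul] at h
    exact tendsto_nhds_unique (hconv y) hzero
  · -- ## (5.4): slice alignment on the concentrating balls
    obtain ⟨M', U, P, H, φ, hφ, hU, hswU, hwgU, hIU, hsingU, hconv⟩ := core hsg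
    have hdir := dir_eq_of_sliceAligned_along (s := s ∘ φ) hη hη0 (fun j => hal (φ j))
      (a := fun j => (T - s (φ j)) / 4) (L := fun j => Real.sqrt (ν * (T - s (φ j))) / 2) (r := 2)
      (fun j => by have := hTs (φ j); positivity) (ha0' hφ) (fun j => hLpos (φ j)) (hL0' hφ)
      (fun j => hLr (φ j)) hconv
    by_cases hex : ∃ y ∈ ball (0 : EuclideanSpace ℝ (Fin 3)) 2, curl (U (-4)) y ≠ 0
    · obtain ⟨y₁, hy₁, hne⟩ := hex
      refine ending hU hswU hwgU hIU hsingU hne fun y hy => ?_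
      by_cases hzero : curl (U (-4)) y = 0
      · exact ⟨0, by rw [hzero, zero_smul]⟩
      · refine ⟨‖curl (U (-4)) y‖ * ‖curl (U (-4)) y₁‖⁻¹, ?_⟩
        rw [← smul_smul, ← hdir y hy y₁ hy₁ hzero hne, smul_smul,
          mul_inv_cancel₀ (norm_ne_zero_iff.2 hzero), one_smul]
    · push Not at hex
      exact ending hU hswU hwgU hIU hsingU he₀ fun y hy => ⟨0, by rw [hex y hy, zero_smul]⟩

end Literature.Analysis.FluidPDE

end
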